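import Literature.NumberTheory.EllipticCurves.HeegnerPointsKolyvaginProp82Proofs

/-!
# Route `GenusKolyvaginAtTwo`, crux #3 `KolyvaginExactAtTwo` (stmt-BirchSwinnertonDyer-22137):
# the HYPERPLANE leaf (PT₂ = Gross Prop. 8.2 at `p = 2`, no eigenspaces) reduced to Kolyvagin
# reciprocity at `λ` — exactly as the tree reduces the odd-`p` Prop. 8.2 (helper, PROVED;
# seat `bsd-line-gk2-p2`, gen 4)

Memo ANALYSIS-22137 v5.3 §4/§8; leaf `HyperplaneAtTwo` of `LeavesAtTwo.lean` (evidence #17 on the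
item). The tree proves Gross's Prop. 8.2 for ODD `p` (`Gross1991_prop_8_2_at_of_reciprocity`,
file `HeegnerPointsKolyvaginProp82Proofs`) from the single hypothesis (R) «Kolyvagin reciprocity at
`λ`»: `e([s, F], [c, σ]) = 0` for Selmer `s`, `c` Selmer off `λ`, `F` a Frobenius at `𝔔 ∣ λ` fixing
`E_p`, `σ ∈ I_𝔔` — local Tate duality + the reciprocity law for `Br K`, not in the tree. At `p = 2`
the eigenspace step of that proof (`L ∩ E_p^ν = 0`, "since `p` is odd") is unavailable; what
survives is the HYPERPLANE form: the tame values of `c` at `λ` contain a non-zero `T'` (Gross (7.1):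
`c_λ ∉` the Selmer kernel), (R) puts `[s, F]` and `[κ, F]` in `T'^⊥ = {0, T'}` (`E[2]` a symplectic
plane), and `[κ, F] ≠ 0` (`κ_λ ≠ 0`, Prop. 9.6) forces `[s, F] ∈ {0, [κ, F]}`, i.e.
**`s ∈ T_λ ∨ s − κ ∈ T_λ`** (`T_λ` the local kernel, by Prop. 9.6 again). No `τ`-structure, no
`FrobEqFrobInfty`: the Frobenius `F` at `𝔔` is a hypothesis (for an inert admissible prime it is the
square of a Frobenius over `ℚ`, supplied by the Čebotarev leaf). This file proves that reduction
(`hyperplane_two_at_of_reciprocity`), for `E = W/ℚ` base-changed to a number field `K`, at a good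
place `w ∌ 2` — verbatim the tree's Steps 0, 7 (first half), 8 (first half), 9. Route-independent
(no `Theses` import). BSD is not proved by any of this.
-/

set_option linter.dupNamespace false

noncomputable section

open scoped Classical Pointwise
open WeierstrassCurve NumberField IsDedekindDomain Field WithZero
open Literature.NumberTheory.GaloisRepresentations Literature.NumberTheory.EllipticCurves
open Literature.NumberTheory.EllipticCurves.KolyvaginReciprocity

universe u

namespace Summit.BirchSwinnertonDyer.BirchSwinnertonDyer.Theorems.GenusExact

/-- In a group killed by `2`, an integer multiple of `g` is `0` or `g`. [folklore] -/
theorem zsmul_eq_zero_or_eq_of_two_nsmul_eq_zero {T : Type*} [AddCommGroup T] {g : T}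
    (hg : (2 : ℕ) • g = 0) (k : ℤ) : k • g = 0 ∨ k • g = g := by
  rcases Int.even_or_odd k with ⟨j, rfl⟩ | ⟨j, rfl⟩
  · left
    rw [add_zsmul, ← zsmul_add, ← two_nsmul, hg, zsmul_zero]
  · right
    rw [add_zsmul, one_zsmul, two_mul, add_zsmul, ← zsmul_add, ← two_nsmul, hg, zsmul_zero,
      zero_add]

variable {K : Type u} [Field K] [NumberField K] (W : WeierstrassCurve ℚ)

/-- **Gross's Prop. 8.2 in HYPERPLANE form, from Kolyvagin reciprocity at `λ`** — for a prime
`p` such that `E[p]` is killed by `2` (i.e. `p = 2`; stated with `p` a variable so that the tree's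
odd-`p` lemmas apply verbatim). Setting: `E = W/ℚ` elliptic, `K` a number field, `w` a finite
place of `K` of good reduction with `p ∉ w` (`λ`, the place of an admissible prime), `𝔔 ∣ w` a
prime of `\bar ℤ_K`, `F ∈ Γ_K` an arithmetic Frobenius at `𝔔` fixing `E[p]`, `e` an alternating
non-degenerate biadditive pairing on `E[p]` (the Weil pairing). Data: `d ∈ H¹(K, E[p])` NOT in the
Selmer local kernel at `w` (Kolyvagin's `c(ℓ)`, by the parity criterion), `κ ∈ Sel^(p)(E/K)` with
`κ_w ≠ 0` (`δ y_K`, admissibility), and (R): `e([x, F], [d, σ]) = 0` for every Selmer `x` and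
`σ ∈ I_𝔔`. Then every `s ∈ Sel^(p)(E/K)` has `s_w = 0` or `s_w = κ_w`: `s ∈ T_w ∨ s − κ ∈ T_w`,
`T_w = ker (H¹(K,E[p]) → H¹(K_w,E[p]))`. [cite: GrossLMS1991, Prop. 8.2 (proof), (7.1), (7.6), Prop. 9.6] -/
theorem hyperplane_at_of_reciprocity [W.IsElliptic] {p : ℕ} (hp : p.Prime)
    (h2 : ∀ P : geomTorsion (W.baseChange K) p, (2 : ℕ) • P = 0)
    {w : HeightOneSpectrum (𝓞 K)}
    (hgood : (W.baseChange K).HasGoodReductionAt w) (hpw' : (p : 𝓞 K) ∉ w.asIdeal)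
    {𝔔 : Ideal (absIntegers (𝓞 K) K)} (h𝔔w : 𝔔 ∈ w.primesAbove)
    {F : absoluteGaloisGroup K} (hF𝔔 : IsArithFrobAt (𝓞 K) F 𝔔)
    (hFfix : F ∈ torsionFixing (W.baseChange K) p)
    {A : Type*} [AddCommGroup A]
    (e : geomTorsion (W.baseChange K) p →+ geomTorsion (W.baseChange K) p →+ A)
    (halt : ∀ x, e x x = 0) (hnd : ∀ x, (∀ y, e x y = 0) → x = 0)
    {d : galH1Torsion (W.baseChange K) p}
    (hdv : d ∉ selmerLocalKer (W.baseChange K) (w.adicCompletion K) p)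
    {κ : galH1Torsion (W.baseChange K) p}
    (hκ : κ ∈ selmerGroup (W.baseChange K) p)
    (hκw : κ ∉ (W.baseChange K).torsionLocalKer (w.adicCompletion K) p)
    {s : galH1Torsion (W.baseChange K) p} (hs : s ∈ selmerGroup (W.baseChange K) p)
    (hR : ∀ x ∈ selmerGroup (W.baseChange K) p, ∀ σ ∈ 𝔔.inertia (absoluteGaloisGroup K),
      e (h1Eval (W.baseChange K) p x F) (h1Eval (W.baseChange K) p d σ) = 0) :
    s ∈ (W.baseChange K).torsionLocalKer (w.adicCompletion K) p ∨
      s - κ ∈ (W.baseChange K).torsionLocalKer (w.adicCompletion K) p := by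
  classical
  haveI : Fact p.Prime := ⟨hp⟩
  have hp0 : (p : ℤ) ≠ 0 := by exact_mod_cast hp.ne_zero
  -- ### Step 0: `p ∉ λ`, `λ` good, `#E[p] = p²`, `p E[p] = 0`
  have hpw : (((p : ℕ) : ℤ) : 𝓞 K) ∉ w.asIdeal := by rwa [Int.cast_natCast]
  have hwbad : w ∉ (W.baseChange K).badPlaces (𝓞 K) := fun h ↦ h hgood
  have hTp : ∀ P : geomTorsion (W.baseChange K) p, p • P = 0 := fun P ↦ by
    have := (mem_geomTorsion_iff (W.baseChange K) p _).mp P.2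
    apply Subtype.ext
    rw [AddSubgroupClass.coe_nsmul, ← natCast_zsmul]
    exact this
  have hcardK : Nat.card (geomTorsion (W.baseChange K) p) = p ^ 2 :=
    card_torsionPoints_eq_sq_holds (W.baseChange K) (AlgebraicClosure K)
      (by exact_mod_cast hp.ne_zero)
  haveI : 𝔔.IsPrime := h𝔔w.1
  -- ### Step 7 (first half): a non-zero tame value `T' = [d, σ₀]` from `d_λ ≠ 0` (Gross (7.1))
  have hd0 : ∃ σ₀ ∈ 𝔔.inertia (absoluteGaloisGroup K), h1Eval (W.baseChange K) p d σ₀ ≠ 0 := by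
    by_contra hall
    push Not at hall
    apply hdv
    rw [← oneCocycleClass_reprCocycle (W.baseChange K) p d]
    exact ((W.baseChange K).oneCocycleClass_mem_selmerLocalKer_iff hgood hpw h𝔔w
      (reprCocycle (W.baseChange K) p d)).mpr fun τ hτ ↦ hall τ hτ
  obtain ⟨σ₀, hσ₀, hT'⟩ := hd0
  -- ### Step 8 (first half): reciprocity puts `[x, F]` in `T'^⊥ = ℤ T' = {0, T'}` for Selmer `x`
  have hline : ∀ x ∈ selmerGroup (W.baseChange K) p,
      h1Eval (W.baseChange K) p x F = 0 ∨
        h1Eval (W.baseChange K) p x F = h1Eval (W.baseChange K) p d σ₀ := by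
    intro x hx
    have hmem : h1Eval (W.baseChange K) p x F ∈
        AddSubgroup.zmultiples (h1Eval (W.baseChange K) p d σ₀) :=
      mem_zmultiples_of_pairing_eq_zero hcardK hTp e halt hnd hT' (hR x hx σ₀ hσ₀)
    obtain ⟨k, hk⟩ := AddSubgroup.mem_zmultiples_iff.mp hmem
    rw [← hk]
    exact zsmul_eq_zero_or_eq_of_two_nsmul_eq_zero (h2 _) k
  -- ### Step 9: Gross's Prop. 9.6 at `λ`: `x_λ = 0 ⟺ [x, F] = 0` for Selmer `x`
  haveI : CharZero (w.adicCompletion K) :=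
    charZero_of_injective_algebraMap (algebraMap K (w.adicCompletion K)).injective
  obtain ⟨𝔐, h𝔐⟩ := w.localPrimesAbove_nonempty
  set 𝔓w := w.primeBelow (closureEmb (K := K) (w.adicCompletion K)) 𝔐 with h𝔓wdef
  have h𝔓w : 𝔓w ∈ w.primesAbove := HeightOneSpectrum.primeBelow_mem_primesAbove h𝔐
  obtain ⟨δ, -, hFδ⟩ :=
    HeightOneSpectrum.exists_isArithFrobAt_conj_of_mem_primesAbove_holds h𝔔w h𝔓w hF𝔔
  have hFT : δ * F * δ⁻¹ ∈ torsionFixing (W.baseChange K) p :=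
    (torsionFixing_normal (W.baseChange K) p).conj_mem _ hFfix δ
  have hcrit : ∀ x ∈ selmerGroup (W.baseChange K) p,
      (x ∈ (W.baseChange K).torsionLocalKer (w.adicCompletion K) p ↔
        h1Eval (W.baseChange K) p x F = 0) := by
    intro x hx
    have hxunr : x ∈ unramifiedKer (geomTorsion (W.baseChange K) p) 𝔓w :=
      selmerLocalKer_le_unramifiedKer (HeightOneSpectrum.exists_mem_inertia_apply_eq_holds w)
        (W.baseChange K).smul_localPoints_eq_of_mem_inertia_holds hwbad hpw h𝔓w
        (((mem_selmerGroup_iff (W.baseChange K) p x).mp hx).1 w)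
    have h := mem_torsionLocalKer_iff_h1Eval_eq_zero (W.baseChange K) (p : ℤ) h𝔐 hFδ hFT
      (inertia_le_torsionFixing (W.baseChange K) hwbad hpw _ h𝔐)
      (isOpen_torsionFixing (W.baseChange K) hp0)
      (torsionPointsMap_bijective (W.baseChange K) (w.adicCompletion K) hp.ne_zero).2 hxunr
    rw [h, h1Eval_conj (W.baseChange K) p x δ hFfix]
    exact smul_eq_zero_iff_eq δ
  -- ### Conclusion: `[κ, F] = T'` and `[s, F] ∈ {0, T'}`
  have hκF : h1Eval (W.baseChange K) p κ F = h1Eval (W.baseChange K) p d σ₀ := by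
    rcases hline κ hκ with h0 | h1
    · exact absurd ((hcrit κ hκ).mpr h0) hκw
    · exact h1
  rcases hline s hs with h0 | h1
  · exact Or.inl ((hcrit s hs).mpr h0)
  · right
    have hsκ : s - κ ∈ selmerGroup (W.baseChange K) p := AddSubgroup.sub_mem _ hs hκ
    apply (hcrit (s - κ) hsκ).mpr
    rw [sub_eq_add_neg, h1Eval_add (W.baseChange K) p s (-κ) hFfix,
      h1Eval_neg (W.baseChange K) p κ hFfix, h1, hκF, add_neg_cancel]

/-- **The case `p = 2`** (where `E[2]` is killed by `2`): Gross's Prop. 8.2 at `2` in hyperplane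
form from (R₂). This is the leaf `HyperplaneAtTwo` of the base-case architecture, reduced to
Kolyvagin reciprocity at `λ`. [cite: GrossLMS1991, Prop. 8.2] -/
theorem hyperplane_two_at_of_reciprocity [W.IsElliptic] {w : HeightOneSpectrum (𝓞 K)}
    (hgood : (W.baseChange K).HasGoodReductionAt w) (h2w : ((2 : ℕ) : 𝓞 K) ∉ w.asIdeal)
    {𝔔 : Ideal (absIntegers (𝓞 K) K)} (h𝔔w : 𝔔 ∈ w.primesAbove)
    {F : absoluteGaloisGroup K} (hF𝔔 : IsArithFrobAt (𝓞 K) F 𝔔)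
    (hFfix : F ∈ torsionFixing (W.baseChange K) (2 : ℕ))
    {A : Type*} [AddCommGroup A]
    (e : geomTorsion (W.baseChange K) (2 : ℕ) →+ geomTorsion (W.baseChange K) (2 : ℕ) →+ A)
    (halt : ∀ x, e x x = 0) (hnd : ∀ x, (∀ y, e x y = 0) → x = 0)
    {d : galH1Torsion (W.baseChange K) (2 : ℕ)}
    (hdv : d ∉ selmerLocalKer (W.baseChange K) (w.adicCompletion K) (2 : ℕ))
    {κ : galH1Torsion (W.baseChange K) (2 : ℕ)}
    (hκ : κ ∈ selmerGroup (W.baseChange K) (2 : ℕ))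
    (hκw : κ ∉ (W.baseChange K).torsionLocalKer (w.adicCompletion K) (2 : ℕ))
    {s : galH1Torsion (W.baseChange K) (2 : ℕ)} (hs : s ∈ selmerGroup (W.baseChange K) (2 : ℕ))
    (hR : ∀ x ∈ selmerGroup (W.baseChange K) (2 : ℕ), ∀ σ ∈ 𝔔.inertia (absoluteGaloisGroup K),
      e (h1Eval (W.baseChange K) (2 : ℕ) x F) (h1Eval (W.baseChange K) (2 : ℕ) d σ) = 0) :
    s ∈ (W.baseChange K).torsionLocalKer (w.adicCompletion K) (2 : ℕ) ∨
      s - κ ∈ (W.baseChange K).torsionLocalKer (w.adicCompletion K) (2 : ℕ) :=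
  hyperplane_at_of_reciprocity W Nat.prime_two (fun P ↦ by
      have := (mem_geomTorsion_iff (W.baseChange K) ((2 : ℕ) : ℤ) _).mp P.2
      apply Subtype.ext
      rw [AddSubgroupClass.coe_nsmul, ← natCast_zsmul]
      exact this)
    hgood h2w h𝔔w hF𝔔 hFfix e halt hnd hdv hκ hκw hs hR

end Summit.BirchSwinnertonDyer.BirchSwinnertonDyer.Theorems.GenusExact

end
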